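import HarnessLib
import Summits.Ventures.WeilGRH.UniformConductorFloorCoprimeRemainder
import Summits.Ventures.WeilGRH.CellMod12One

/-!
# GRH arm (rh-explicit, venture WeilGRH): Weil positivity on `[−1, 1]` for EVERY non-principal Dirichlet character mod 12

Cell `rh-explicit`, WEIL TRACK — GRH ARM (engine seat weil-grh-2 gen16).  `(ℤ/12)ˣ = {1, 5, 7, 11}` is the Klein four-group, so a
character `χ` mod 12 is determined by `(χ(5), χ(7)) ∈ {±1}²`:  `(1, 1)` is the principal character (which FAILS Weil positivity on
`[−1, 1]`, `12 ∈ F` — `UniformConductorFloorPrincipal`); `(−1, −1)` is the primitive even real character `(12/·)`, certified by the island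
`CellMod12One.weilPositivityOnChar_mod_twelve_one` (weil-grh-2 gen13); `(−1, 1)` and `(1, −1)` are ODD (`χ(−1) = χ(5)χ(7) = −1`: the lifts of
`(−4/·)` and `(−3/·)`), covered by the tree's `t = 1` odd floor `UniformFloor.weilPositivityOnChar_one_of_odd_not_mem_remainder` (`12 ∉ R₁`).
Hence the level-12 picture at `t = 1` is complete: exactly the principal character fails.  Pure assembly; RH/GRH-free; standard axioms.
-/

noncomputable section

namespace Summit.Ventures.WeilGRH.OneCompleteMod12
open Literature.NumberTheory.LFunctions

/-- The units mod 12 are `1, 5, 7, 5·7 = 11`. [folklore] -/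
theorem units_mod12 : ∀ u : (ZMod 12)ˣ, (u : ZMod 12) = 1 ∨ (u : ZMod 12) = 5 ∨ (u : ZMod 12) = 7 ∨ (u : ZMod 12) = 5 * 7 := by
  decide

/-- A character value at an element of order `2` is `±1`. [folklore] -/
theorem apply_eq_one_or_neg_one_of_sq (χ : DirichletCharacter ℂ 12) {x : ZMod 12} (hx : x * x = 1) :
    χ x = 1 ∨ χ x = -1 :=
  mul_self_eq_one_iff.mp (by rw [← map_mul, hx, map_one])

/-- ★ **Every non-principal Dirichlet character mod 12 satisfies Weil positivity on `[−1, 1]`** (`WeilPositivityOnChar χ 1`); the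
principal character mod 12 fails, so `χ ≠ 1` is sharp. [cite: Weil1952FormulesExplicites, (11) pp. 261–262 and the «lemme» p. 262] -/
theorem weilPositivityOnChar_mod12_one (χ : DirichletCharacter ℂ 12) (hχ : χ ≠ 1) : WeilPositivityOnChar χ 1 := by
  have h5 := apply_eq_one_or_neg_one_of_sq χ (x := 5) (by decide)
  have h7 := apply_eq_one_or_neg_one_of_sq χ (x := 7) (by decide)
  have hm1 : χ (-1) = χ 5 * χ 7 := by
    rw [← map_mul, show (5 : ZMod 12) * 7 = -1 from by decide]
  rcases h5 with h5 | h5 <;> rcases h7 with h7 | h7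
  · -- (1, 1): the principal character
    refine absurd ?_ hχ
    ext u
    rw [MulChar.one_apply_coe]
    rcases units_mod12 u with h | h | h | h <;> simp only [h, map_one, map_mul, h5, h7, mul_one]
  · -- (1, −1): odd
    have ho : χ.Odd := by show χ (-1) = -1; rw [hm1, h5, h7]; norm_num
    exact UniformFloor.weilPositivityOnChar_one_of_odd_not_mem_remainder (by decide) χ (charParity_of_odd ho)
  · -- (−1, 1): odd
    have ho : χ.Odd := by show χ (-1) = -1; rw [hm1, h5, h7]; norm_num
    exact UniformFloor.weilPositivityOnChar_one_of_odd_not_mem_remainder (by decide) χ (charParity_of_odd ho)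
  · -- (−1, −1): the real primitive character `(12/·)`
    exact CellMod12One.weilPositivityOnChar_mod_twelve_one χ h5 h7

/-- The same on every window `t ≤ 1`. [folklore] -/
theorem weilPositivityOnChar_of_le_one_mod12 (χ : DirichletCharacter ℂ 12) (hχ : χ ≠ 1) {t : ℝ} (ht : t ≤ 1) :
    WeilPositivityOnChar χ t := fun g hg hsupp ↦
  weilPositivityOnChar_mod12_one χ hχ g hg (hsupp.trans (Set.Icc_subset_Icc (by linarith) ht))

end Summit.Ventures.WeilGRH.OneCompleteMod12

end
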